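/-
Copyright (c) 2026. All rights reserved.
Released under Apache 2.0 license as described in the file LICENSE.
-/
import Literature.NumberTheory.Automorphic.EichlerOrdersGenusTwoSidedIdeals
import HarnessLib

/-!
# The group law of the two-sided ideals of an Eichler order: supports multiply by symmetric difference, and
# `N(O)/O^×` is abelian with `N(O)/ℚ^×O^×` of exponent `2` (Voight (23.4.20), Lemma 18.5.1, Prop. 18.5.3, Prop. 23.4.14)

[tag: quaternion_algebra] [tag: eichler_order] [tag: class_number]

Topic `NumberTheory/Automorphic`; THEOREMS ONLY (no definition, no named fact, no instance, no notation; net debt `0`).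
Lane `lit-hodgefound`, seat p12, gen 54 — the MULTIPLICATIVE structure behind Voight (23.4.20) for the Eichler order `O` of a
Brandt setup `S : XiSetup N⁺ N⁻` (definite quaternion algebra `D` over `ℚ` of discriminant `N⁻`, Eichler order of level `N⁺`),
on top of `EichlerOrderTwoSidedIdealsNormaliser.lean` (squares `O P_l · O P_l = (∏ localNorm) O`, commutation of the `T_r`,
Lemma 18.5.1 for `x ∈ N(O)`: `O P_l(O) = (q x) O`) and `BrandtSetupTwoSidedIdealNorms.lean` (principal ⟺ norm element).

THE PRINTED STATEMENTS (J. Voight, *Quaternion Algebras*, GTM 288). **(23.4.20)**: `0 → Idl(R) → Idl(O) → ∏_{𝔭 ∣ 𝔑} ℤ/2ℤ → 0`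
is an exact sequence OF GROUPS — the class of `∏_{𝔭 ∈ s} T_𝔭` times that of `∏_{𝔭 ∈ s'} T_𝔭` is the class of
`∏_{𝔭 ∈ s ∆ s'} T_𝔭` (locally, Prop. 23.4.14: `Idl(O_𝔭)` «is abelian, generated by `I` and `𝔭O` with the single relation
`I² = 𝔭^e O`»; 23.3.19 at the ramified primes: `P² = 𝔭O`). **Lemma 18.5.1**: `1 → O^× → N_{B^×}(O) → PIdl(O) → 1`, so
`N_{B^×}(O)/O^× ≅ PIdl(O) ≤ Idl(O)` is ABELIAN; **Prop. 18.5.3**: `N_{B^×}(O)/(F^×O^×) ≅ PIdl(O)/PIdl(R) ≤ Idl(O)/Idl(R) ≅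
∏_{𝔭 ∣ 𝔑} ℤ/2ℤ` has EXPONENT `2`.

With the tree's `T_r(O) = XiSetup.twoSidedIdeal`, `P_l(O) = XiSetup.twoSidedIdealProd` (a LIST `l` of primes),
`localNorm N⁺ N⁻ r`, the normaliser condition `x • (op x⁻¹ • O) = O` and `MulAction.stabilizer D^× O` (`= O^×`), this file
proves, for `O = S.O`:

* §1 **THE SYMMETRIC-DIFFERENCE LAW `O P_l(O) · O P_{l'}(O) = (∏_{r ∈ l ∩ l'} localNorm r) · O P_{l''}(O)`** for duplicate-free
  lists of primes `l, l'` and ANY duplicate-free `l''` whose members are those of the symmetric difference `l ∆ l'`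
  (`XiSetup.order_mul_twoSidedIdealProd_mul_order_mul_twoSidedIdealProd`); disjoint supports: `= O P_{l ++ l'}(O)`; the
  products `O P_l(O)` commute; in sign-vector form for `g, g' ∈ (ℤ/2ℤ)^T`: `O P_{supp g} · O P_{supp g'} = n · O P_{supp (g g')}`;
* §2 **PRINCIPAL CLASSES MULTIPLY: if `O P_l(O) = y O` and `O P_{l'}(O) = y' O` then `O P_{l''}(O) = (y y'/n) O`**, `n = ∏_{l ∩ l'}
  localNorm` (`XiSetup.exists_order_mul_twoSidedIdealProd_eq_units_smul_of_symmDiff`); hence **the set of `g ∈ (ℤ/2ℤ)^T` whose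
  `O P_{supp g}(O)` contains an element of reduced norm `∏ localNorm` is closed under multiplication** (the arithmetic stabiliser
  of `BrandtSetupTypeFibreCardinality.lean` is a subgroup);
* §3 **THE NORMALISER: for `x, x' ∈ N(O)` with supports `l, l'`, the product `x x'` generates `O P_{l ∆ l'}(O)` up to `ℚ^×`**
  (`XiSetup.exists_order_mul_twoSidedIdealProd_eq_units_smul_mul_of_conj_eq` — the map `N(O) → Idl(O)/Idl(ℤ)`, `x ↦ supp(OxO)`,
  is multiplicative); **`x² ∈ ℚ^× O^×`** (`XiSetup.exists_sq_mem_stabilizer_of_conj_eq`: `N(O)/ℚ^×O^×` has exponent `2`);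
  **the commutator `x⁻¹ x'⁻¹ x x'` lies in `O^×`** (`XiSetup.commutator_mem_stabilizer_of_conj_eq`: `N(O)/O^×` is abelian,
  Lemma 18.5.1 with (23.4.20)); and `N(O)` is closed under products;
* §4 the same for every left order `O_L(I)` (setup `S.ofLeftOrder hI`).

## References

* [Voight2021] J. Voight, *Quaternion Algebras*, GTM 288 (2021): Lemma 18.5.1, Prop. 18.5.3, 18.5.7, Thm. 18.1.3, 23.3.19,
  Prop. 23.4.14, 23.4.19, (23.4.20)–(23.4.21).
* [VignerasLNM800] M.-F. Vignéras, *Arithmétique des algèbres de quaternions*, LNM 800 (1980), Ch. II §1 Cor. 1.7, Ch. II §2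
  (normalisateur d'un ordre d'Eichler), Ch. III §5 exercice 5.8.

## Scope (honest)

Theorems only; no quotient group is constructed — «abelian» and «exponent 2» are stated elementwise (commutators in `O^×`,
squares in `ℚ^× O^×`). Uniqueness of the support is the companion file `EichlerOrderTwoSidedIdealsUniqueness.lean`.
-/

noncomputable section

open scoped Pointwise

universe u

namespace Literature.NumberTheory.Automorphic

open AtkinLehner

namespace Brandt

variable {Nplus Nminus : ℕ} (S : XiSetup Nplus Nminus)

/-! ## §0 Elementary lemmas -/

/-- The algebra of a setup is a division algebra. [folklore] -/
private theorem XiSetup.hdiv₆₁ : ∀ x : S.D, x ≠ 0 → IsUnit x :=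
  fun _ hx => isUnit_of_isTotallyDefinite S.D S.isTotallyDefinite hx

/-- The reduced norm of a unit is non-zero. [folklore] -/
private theorem XiSetup.reducedNorm_units_ne_zero₆₁ (u : S.Dˣ) : reducedNorm ℚ S.D (u : S.D) ≠ 0 :=
  (isUnit_iff_reducedNorm_ne_zero_holds ℚ S.D (u : S.D)).mp u.isUnit

/-- A central unit `ν = n · 1` acts as the integer `n`: `ν J = n J`. [folklore] -/
private theorem units_smul_eq_natCast_smul₆₁ {D : Type u} [Ring D] {ν : Dˣ} {n : ℕ} (hν : (ν : D) = (n : ℤ))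
    (J : Submodule ℤ D) : ν • J = (n : ℤ) • J := by
  ext x
  constructor
  · intro hx
    obtain ⟨y, hy, rfl⟩ := exists_eq_zsmul_of_mem_units_smul hν hx
    exact Submodule.smul_mem_pointwise_smul y _ J hy
  · intro hx
    obtain ⟨y, hy, rfl⟩ := (Submodule.mem_smul_pointwise_iff_exists x _ J).mp hx
    exact units_smul_eq_zsmul_of_val_eq hν J hy

/-- `(n I) T = n (I T)` for a natural number `n ≠ 0`. [folklore] -/
private theorem XiSetup.natCast_smul_mul₆₁ {n : ℕ} (hn : n ≠ 0) (I T : Submodule ℤ S.D) :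
    ((n : ℤ) • I) * T = (n : ℤ) • (I * T) := by
  obtain ⟨ν, hν, -⟩ := exists_units_val_eq_natCast (D := S.D) hn
  rw [← units_smul_eq_natCast_smul₆₁ hν, ← units_smul_eq_natCast_smul₆₁ hν, smul_mul_assoc]

/-- A central unit `ν = k · 1`, `k ∈ ℕ`, is `algebraMap ℚ D k`. [folklore] -/
private theorem val_eq_algebraMap_of_val_eq_natCast₆₁ {D : Type u} [Ring D] [Algebra ℚ D] {ν : Dˣ} {k : ℕ}
    (hν : (ν : D) = (k : ℤ)) : (ν : D) = algebraMap ℚ D (k : ℚ) := by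
  rw [map_natCast, hν, Int.cast_natCast]

/-- The inverse of a central unit `ν = q · 1` is `q⁻¹ · 1`. [folklore] -/
private theorem val_inv_eq_algebraMap₆₁ {D : Type u} [Ring D] [Algebra ℚ D] {q : ℚ} (hq : q ≠ 0) {ν : Dˣ}
    (hν : (ν : D) = algebraMap ℚ D q) : ((ν⁻¹ : Dˣ) : D) = algebraMap ℚ D q⁻¹ :=
  Units.inv_eq_of_mul_eq_one_right (by rw [hν, ← map_mul, mul_inv_cancel₀ hq, map_one])

/-- The product of local norms over a list of primes is non-zero. [folklore] -/
private theorem prod_localNorm_ne_zero₆₁ {l : List ℕ} (hl : ∀ r ∈ l, r.Prime) : (l.map (localNorm Nplus Nminus)).prod ≠ 0 :=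
  List.prod_ne_zero fun h => by
    obtain ⟨r', hr', h0⟩ := List.mem_map.mp h
    exact localNorm_ne_zero (hl r' hr').ne_zero h0

/-- `I O = I` for a right `O`-ideal `I`. [folklore] -/
private theorem XiSetup.mul_order_eq_self₆₁ {I : Submodule ℤ S.D} (hI : I ∈ rightIdeals S.O) : I * S.O = I := by
  have h := Brandt.mul_rightOrder_self I
  rwa [hI.2.1] at h

/-- `T_r (O P_l(O)) = (O P_l(O)) T_r`: an admissible ideal commutes with every product. [cite: VignerasLNM800, Ch. III §5 exercice 5.8 (c)–(d)] -/
private theorem XiSetup.twoSidedIdeal_mul_order_mul_twoSidedIdealProd₆₁ {r : ℕ} (hr : r.Prime) {l : List ℕ} (hl : ∀ r' ∈ l, r'.Prime) :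
    S.twoSidedIdeal S.O r * (S.O * S.twoSidedIdealProd S.O l) = (S.O * S.twoSidedIdealProd S.O l) * S.twoSidedIdeal S.O r := by
  have hO := S.isZOrder_O
  rw [← mul_assoc, S.twoSidedIdeal_mul_order hO, S.order_mul_twoSidedIdealProd hO l, mul_assoc, S.order_mul_twoSidedIdeal hO,
    S.twoSidedIdeal_mul_twoSidedIdealProd_comm hO hr hl]

/-- `(a x)(b x') = (a b)(x x')` for central scalars `a, b ∈ ℚ`. [folklore] -/
private theorem algebraMap_mul_mul_algebraMap_mul₆₁ {D : Type u} [Ring D] [Algebra ℚ D] (a b : ℚ) (x x' : D) :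
    (algebraMap ℚ D a * x) * (algebraMap ℚ D b * x') = algebraMap ℚ D (a * b) * (x * x') := by
  rw [map_mul, mul_assoc, mul_assoc, ← mul_assoc x, ← Algebra.commutes b x, mul_assoc]

/-- `(g g')(i) ≠ 1 ⟺ (g i ≠ 1 xor g' i ≠ 1)` in `(ℤ/2ℤ)^T`: the support of a product is the symmetric difference. [folklore] -/
private theorem mul_apply_ne_one_iff₆₁ {T : Finset ℕ} (g g' : T → Multiplicative (ZMod 2)) (i : T) :
    (g * g') i ≠ 1 ↔ (g i ≠ 1 ↔ ¬ g' i ≠ 1) := by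
  rw [Pi.mul_apply]
  generalize g i = a, g' i = b
  revert a b; decide

/-- Primality along `L ++ [r]`. [folklore] -/
private theorem prime_append_singleton₆₁ {L : List ℕ} {r : ℕ} (hL : ∀ r' ∈ L, r'.Prime) (hr : r.Prime) :
    ∀ r' ∈ L ++ [r], r'.Prime := fun r' h =>
  (List.mem_append.mp h).elim (hL r') fun h => by rw [List.mem_singleton.mp h]; exact hr

/-- The support of a product of sign vectors is the symmetric difference of the supports. [folklore] -/
private theorem mem_suppSort_mul_iff₆₁ (T : Finset ℕ) (g g' : T → Multiplicative (ZMod 2)) (r : ℕ) :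
    r ∈ suppSort T (g * g') ↔ (r ∈ suppSort T g ↔ r ∉ suppSort T g') := by
  rw [mem_suppSort_iff, mem_suppSort_iff, mem_suppSort_iff]
  constructor
  · rintro ⟨h, hne⟩
    rw [mul_apply_ne_one_iff₆₁] at hne
    constructor
    · rintro ⟨_, hg⟩ ⟨_, hg'⟩; exact (hne.mp hg) hg'
    · intro hg'; exact ⟨h, hne.mpr fun hg'' => hg' ⟨h, hg''⟩⟩
  · intro hiff
    by_cases hg : ∃ h : r ∈ T, g ⟨r, h⟩ ≠ 1
    · obtain ⟨h, hne⟩ := hg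
      exact ⟨h, (mul_apply_ne_one_iff₆₁ g g' _).mpr (iff_of_true hne fun hg' => hiff.mp ⟨h, hne⟩ ⟨h, hg'⟩)⟩
    · have hg' : ∃ h : r ∈ T, g' ⟨r, h⟩ ≠ 1 := by by_contra h'; exact hg (hiff.mpr h')
      obtain ⟨h, hne⟩ := hg'
      exact ⟨h, (mul_apply_ne_one_iff₆₁ g g' _).mpr (iff_of_false (fun hne' => hg ⟨h, hne'⟩) (not_not_intro hne))⟩

/-- A duplicate-free list realising the symmetric difference of two duplicate-free lists exists. [folklore] -/
private theorem exists_symmDiff_list₆₁ {l l' : List ℕ} (hnd : l.Nodup) (hnd' : l'.Nodup) :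
    ∃ l'' : List ℕ, l''.Nodup ∧ ∀ r, r ∈ l'' ↔ (r ∈ l ↔ r ∉ l') := by
  refine ⟨l.filter (· ∉ l') ++ l'.filter (· ∉ l), ?_, fun r => ?_⟩
  · refine List.nodup_append.mpr ⟨hnd.filter _, hnd'.filter _, fun a ha b hb => ?_⟩
    simp only [List.mem_filter, decide_eq_true_eq] at ha hb
    rintro rfl
    exact ha.2 hb.1
  · simp only [List.mem_append, List.mem_filter, decide_eq_true_eq]
    tauto

/-- Members of a symmetric difference are members of one of the lists (hence prime when both lists consist of primes). [folklore] -/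
private theorem prime_of_mem_symmDiff₆₁ {l l' l'' : List ℕ} (hl : ∀ r ∈ l, r.Prime) (hl' : ∀ r ∈ l', r.Prime)
    (hmem : ∀ r, r ∈ l'' ↔ (r ∈ l ↔ r ∉ l')) : ∀ r ∈ l'', r.Prime := fun r hr => by
  by_cases h : r ∈ l
  · exact hl r h
  · exact hl' r (by have := (hmem r).mp hr; tauto)

/-! ## §1 The symmetric-difference law for products of admissible ideals -/

/-- **THE GROUP LAW OF `Idl(O)/Idl(ℤ) ≅ (ℤ/2ℤ)^{ω(N)}`: for duplicate-free lists of primes `l, l'` and any duplicate-free `l''`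
with `r ∈ l'' ⟺ (r ∈ l xor r ∈ l')`,
`O P_l(O) · O P_{l'}(O) = (∏_{r ∈ l, r ∈ l'} localNorm r) · O P_{l''}(O)`** — the admissible ideals commute and square to
`localNorm r · O` (`𝔓_q² = qO`, `𝔔_{p^e}² = p^e O`). [cite: Voight2021, (23.4.20) with Prop. 23.4.14 and 23.3.19] [cite: VignerasLNM800, Ch. III §5 exercice 5.8] -/
theorem XiSetup.order_mul_twoSidedIdealProd_mul_order_mul_twoSidedIdealProd {l l' l'' : List ℕ} (hl : ∀ r ∈ l, r.Prime)
    (hnd : l.Nodup) (hl' : ∀ r ∈ l', r.Prime) (hnd' : l'.Nodup) (hnd'' : l''.Nodup) (hmem : ∀ r, r ∈ l'' ↔ (r ∈ l ↔ r ∉ l')) :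
    (S.O * S.twoSidedIdealProd S.O l) * (S.O * S.twoSidedIdealProd S.O l') =
      (((l.filter (· ∈ l')).map (localNorm Nplus Nminus)).prod : ℤ) • (S.O * S.twoSidedIdealProd S.O l'') := by
  have hO := S.isZOrder_O
  induction l generalizing l'' with
  | nil =>
    have hperm : l''.Perm l' := (List.perm_ext_iff_of_nodup hnd'' hnd').mpr fun r => by rw [hmem r]; simp
    rw [S.twoSidedIdealProd_nil, mul_one, ← mul_assoc, hO.mul_self, List.filter_nil, List.map_nil, List.prod_nil, Nat.cast_one,
      one_smul, S.twoSidedIdealProd_perm hO (prime_of_mem_symmDiff₆₁ (by simp) hl' hmem) hperm]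
  | cons r l₀ ih =>
    have hr : r.Prime := hl r (by simp)
    have hl₀ : ∀ r' ∈ l₀, r'.Prime := fun r' h => hl r' (List.mem_cons_of_mem _ h)
    obtain ⟨hrl₀, hnd₀⟩ := List.nodup_cons.mp hnd
    have hl''p := prime_of_mem_symmDiff₆₁ hl hl' hmem
    -- peel `T_r` to the right: `O P_{r :: l₀} = O P_{l₀} T_r`, and move it past `O P_{l'}`
    have e1 : S.O * S.twoSidedIdealProd S.O (r :: l₀) = S.O * S.twoSidedIdealProd S.O l₀ * S.twoSidedIdeal S.O r := by
      rw [S.twoSidedIdealProd_perm hO hl (List.perm_append_singleton r l₀).symm, S.twoSidedIdealProd_concat, mul_assoc]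
    rw [e1, mul_assoc, S.twoSidedIdeal_mul_order_mul_twoSidedIdealProd₆₁ hr hl', ← mul_assoc]
    by_cases hr' : r ∈ l'
    · -- `r ∈ l ∩ l'`: the symmetric difference of `l₀, l'` is `r :: l''`
      have hrl'' : r ∉ l'' := fun h => by have := (hmem r).mp h; simp [hr'] at this
      have hl₁ : ∀ r' ∈ r :: l'', r'.Prime := fun r' h => (List.mem_cons.mp h).elim (fun e => e ▸ hr) (hl''p r')
      have hmem₀ : ∀ r', r' ∈ r :: l'' ↔ (r' ∈ l₀ ↔ r' ∉ l') := fun r' => by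
        rw [List.mem_cons, hmem r', List.mem_cons]
        by_cases h : r' = r
        · subst h; simp [hr', hrl₀]
        · simp [h]
      rw [ih hl₀ hnd₀ (List.nodup_cons.mpr ⟨hrl'', hnd''⟩) hmem₀, S.natCast_smul_mul₆₁ (prod_localNorm_ne_zero₆₁ fun r' h =>
          hl₀ r' (List.mem_filter.mp h).1), mul_assoc, ← S.twoSidedIdealProd_concat,
        S.twoSidedIdealProd_perm hO (prime_append_singleton₆₁ hl₁ hr) (List.perm_append_comm (l₁ := r :: l'') (l₂ := [r])),
        List.singleton_append, S.mul_twoSidedIdealProd_cons_cons_self hr l'' S.self_mem_rightIdeals, ← mul_smul,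
        List.filter_cons_of_pos (by simpa using hr'), List.map_cons, List.prod_cons, Nat.cast_mul, mul_comm]
    · -- `r ∈ l ∖ l'`: the symmetric difference of `l₀, l'` is `l''.erase r`
      have hrl'' : r ∈ l'' := (hmem r).mpr (by simp [hr', hrl₀])
      have hmem₀ : ∀ r', r' ∈ l''.erase r ↔ (r' ∈ l₀ ↔ r' ∉ l') := fun r' => by
        rw [hnd''.mem_erase_iff, hmem r', List.mem_cons]
        by_cases h : r' = r
        · subst h; simp [hr', hrl₀]
        · simp [h]
      have hle : ∀ r' ∈ l''.erase r, r'.Prime := fun r' h => hl''p r' (List.erase_subset h)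
      rw [ih hl₀ hnd₀ (hnd''.erase r) hmem₀, S.natCast_smul_mul₆₁ (prod_localNorm_ne_zero₆₁ fun r' h =>
          hl₀ r' (List.mem_filter.mp h).1), mul_assoc, ← S.twoSidedIdealProd_concat,
        S.twoSidedIdealProd_perm hO (prime_append_singleton₆₁ hle hr)
          ((List.perm_append_comm (l₁ := l''.erase r) (l₂ := [r])).trans (List.perm_cons_erase hrl'').symm),
        List.filter_cons_of_neg (by simpa using hr')]

/-- **Disjoint supports: `O P_l(O) · O P_{l'}(O) = O P_{l ++ l'}(O)`** when `l` and `l'` share no prime. [cite: Voight2021, (23.4.20)] -/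
theorem XiSetup.order_mul_twoSidedIdealProd_mul_order_mul_twoSidedIdealProd_of_disjoint {l l' : List ℕ} (hl : ∀ r ∈ l, r.Prime)
    (hnd : l.Nodup) (hl' : ∀ r ∈ l', r.Prime) (hnd' : l'.Nodup) (hdis : l.Disjoint l') :
    (S.O * S.twoSidedIdealProd S.O l) * (S.O * S.twoSidedIdealProd S.O l') = S.O * S.twoSidedIdealProd S.O (l ++ l') := by
  have hfil : l.filter (· ∈ l') = [] := List.filter_eq_nil_iff.mpr fun r hr h => hdis hr (by simpa using h)
  have hmem : ∀ r, r ∈ l ++ l' ↔ (r ∈ l ↔ r ∉ l') := fun r => by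
    rw [List.mem_append]
    by_cases h : r ∈ l
    · exact iff_of_true (Or.inl h) (iff_of_true h (hdis h))
    · by_cases h' : r ∈ l'
      · exact iff_of_true (Or.inr h') (iff_of_false h (not_not_intro h'))
      · exact iff_of_false (by tauto) (by tauto)
  rw [S.order_mul_twoSidedIdealProd_mul_order_mul_twoSidedIdealProd hl hnd hl' hnd'
    (List.nodup_append.mpr ⟨hnd, hnd', fun a ha b hb hab => hdis ha (hab ▸ hb)⟩) hmem,
    hfil, List.map_nil, List.prod_nil, Nat.cast_one, one_smul]

/-- **The two-sided ideals `O P_l(O)` commute: `O P_l(O) · O P_{l'}(O) = O P_{l'}(O) · O P_l(O)`** (`Idl(O)` of an Eichler order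
over `ℤ` is abelian). [cite: Voight2021, (23.4.20) and 18.5.7] [cite: VignerasLNM800, Ch. III §5 exercice 5.8 (d)] -/
theorem XiSetup.order_mul_twoSidedIdealProd_mul_comm {l l' : List ℕ} (hl : ∀ r ∈ l, r.Prime) (hnd : l.Nodup)
    (hl' : ∀ r ∈ l', r.Prime) (hnd' : l'.Nodup) :
    (S.O * S.twoSidedIdealProd S.O l) * (S.O * S.twoSidedIdealProd S.O l') =
      (S.O * S.twoSidedIdealProd S.O l') * (S.O * S.twoSidedIdealProd S.O l) := by
  obtain ⟨l'', hnd'', hmem⟩ := exists_symmDiff_list₆₁ hnd hnd'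
  have hmem' : ∀ r, r ∈ l'' ↔ (r ∈ l' ↔ r ∉ l) := fun r => by rw [hmem r]; tauto
  have hperm : (l.filter (· ∈ l')).Perm (l'.filter (· ∈ l)) :=
    (List.perm_ext_iff_of_nodup (hnd.filter _) (hnd'.filter _)).mpr fun r => by
      simp only [List.mem_filter, decide_eq_true_eq]; tauto
  rw [S.order_mul_twoSidedIdealProd_mul_order_mul_twoSidedIdealProd hl hnd hl' hnd' hnd'' hmem,
    S.order_mul_twoSidedIdealProd_mul_order_mul_twoSidedIdealProd hl' hnd' hl hnd hnd'' hmem', (hperm.map _).prod_eq]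

/-- **SIGN-VECTOR FORM: `O P_{supp g}(O) · O P_{supp g'}(O) = (∏_{r ∈ supp g ∩ supp g'} localNorm r) · O P_{supp (g g')}(O)`** for
`g, g' ∈ (ℤ/2ℤ)^T`, `T` a finite set of primes — the class of `O P_{supp g}(O)` in `Idl(O)/Idl(ℤ)` depends multiplicatively on
`g`. [cite: Voight2021, (23.4.20)] [cite: Martin2018, §4.1 (the group `(ℤ/2ℤ)^S` acting by the local involutions)] -/
theorem XiSetup.order_mul_twoSidedIdealProd_suppSort_mul (T : Finset ℕ) (hT : ∀ r ∈ T, r.Prime)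
    (g g' : T → Multiplicative (ZMod 2)) :
    (S.O * S.twoSidedIdealProd S.O (suppSort T g)) * (S.O * S.twoSidedIdealProd S.O (suppSort T g')) =
      ((((suppSort T g).filter (· ∈ suppSort T g')).map (localNorm Nplus Nminus)).prod : ℤ) •
        (S.O * S.twoSidedIdealProd S.O (suppSort T (g * g'))) :=
  S.order_mul_twoSidedIdealProd_mul_order_mul_twoSidedIdealProd (fun _ h => prime_of_mem_suppSort T hT g h) (nodup_suppSort T g)
    (fun _ h => prime_of_mem_suppSort T hT g' h) (nodup_suppSort T g') (nodup_suppSort T _) (mem_suppSort_mul_iff₆₁ T g g')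

/-! ## §2 Principal classes multiply -/

/-- **PRODUCT OF PRINCIPAL ADMISSIBLE IDEALS: if `O P_l(O) = y O` and `O P_{l'}(O) = y' O` then
`O P_{l''}(O) = y'' O` with `y'' = n⁻¹ y y'`, `n = ∏_{r ∈ l ∩ l'} localNorm r`**, for any duplicate-free `l''` realising `l ∆ l'`
(`(yO)(y'O) = y (O · O P_{l'}) = y y' O`): `PIdl(O)/PIdl(ℤ)` is a subgroup of `Idl(O)/Idl(ℤ)`.
[cite: Voight2021, Lemma 18.5.1 and (23.4.20)] -/
theorem XiSetup.exists_order_mul_twoSidedIdealProd_eq_units_smul_of_symmDiff {l l' l'' : List ℕ} (hl : ∀ r ∈ l, r.Prime)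
    (hnd : l.Nodup) (hl' : ∀ r ∈ l', r.Prime) (hnd' : l'.Nodup) (hnd'' : l''.Nodup) (hmem : ∀ r, r ∈ l'' ↔ (r ∈ l ↔ r ∉ l'))
    {y y' : S.Dˣ} (h : S.O * S.twoSidedIdealProd S.O l = y • S.O) (h' : S.O * S.twoSidedIdealProd S.O l' = y' • S.O) :
    ∃ y'' : S.Dˣ, (y'' : S.D) = algebraMap ℚ S.D ((((l.filter (· ∈ l')).map (localNorm Nplus Nminus)).prod : ℕ) : ℚ)⁻¹ * (y * y') ∧
      S.O * S.twoSidedIdealProd S.O l'' = y'' • S.O := by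
  have hO := S.isZOrder_O
  set n := ((l.filter (· ∈ l')).map (localNorm Nplus Nminus)).prod with hn
  have hn0 : n ≠ 0 := prod_localNorm_ne_zero₆₁ fun r' hr => hl r' (List.mem_filter.mp hr).1
  obtain ⟨ν, hν, -⟩ := exists_units_val_eq_natCast (D := S.D) hn0
  have key := S.order_mul_twoSidedIdealProd_mul_order_mul_twoSidedIdealProd hl hnd hl' hnd' hnd'' hmem
  -- `(yO)(y'O) = y y' O`
  have hOJ : S.O * (S.O * S.twoSidedIdealProd S.O l') = S.O * S.twoSidedIdealProd S.O l' := by rw [← mul_assoc, hO.mul_self]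
  rw [h, smul_mul_assoc, hOJ, h', ← mul_smul, ← hn, ← units_smul_eq_natCast_smul₆₁ hν, eq_comm, ← eq_inv_smul_iff,
    ← mul_smul] at key
  exact ⟨ν⁻¹ * (y * y'), by rw [Units.val_mul, Units.val_mul, val_inv_eq_algebraMap₆₁ (by exact_mod_cast hn0)
    (val_eq_algebraMap_of_val_eq_natCast₆₁ hν)], key⟩

/-- **Disjoint supports: `O P_l(O) = yO`, `O P_{l'}(O) = y'O`, `l ∩ l' = ∅` ⟹ `O P_{l ++ l'}(O) = (y y') O`.** [cite: Voight2021, Lemma 18.5.1 and (23.4.20)] -/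
theorem XiSetup.order_mul_twoSidedIdealProd_append_eq_units_smul_of_disjoint {l l' : List ℕ} (hl : ∀ r ∈ l, r.Prime)
    (hnd : l.Nodup) (hl' : ∀ r ∈ l', r.Prime) (hnd' : l'.Nodup) (hdis : l.Disjoint l') {y y' : S.Dˣ}
    (h : S.O * S.twoSidedIdealProd S.O l = y • S.O) (h' : S.O * S.twoSidedIdealProd S.O l' = y' • S.O) :
    S.O * S.twoSidedIdealProd S.O (l ++ l') = (y * y') • S.O := by
  have hO := S.isZOrder_O
  rw [← S.order_mul_twoSidedIdealProd_mul_order_mul_twoSidedIdealProd_of_disjoint hl hnd hl' hnd' hdis, h, h', smul_mul_assoc,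
    mul_smul]
  congr 1
  rw [← h', ← mul_assoc, hO.mul_self]

/-- **Squares are scalar: `O P_l(O) = yO` ⟹ `y² O = (∏_{r ∈ l} localNorm r) O`, i.e. `n⁻¹ y²` stabilises `O`** (is a unit of
`O`): the class of `y` in `N(O)/ℚ^×O^×` has order `≤ 2`. [cite: Voight2021, Prop. 18.5.3 with (23.4.20), and Prop. 23.4.14 (`ϖ² = π^e`)] -/
theorem XiSetup.exists_mem_stabilizer_eq_sq_of_order_mul_twoSidedIdealProd_eq_units_smul {l : List ℕ} (hl : ∀ r ∈ l, r.Prime)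
    (hnd : l.Nodup) {y : S.Dˣ} (h : S.O * S.twoSidedIdealProd S.O l = y • S.O) :
    ∃ u ∈ MulAction.stabilizer S.Dˣ S.O,
      (u : S.D) = algebraMap ℚ S.D (((l.map (localNorm Nplus Nminus)).prod : ℕ) : ℚ)⁻¹ * (y * y) := by
  have hfil : l.filter (· ∈ l) = l := List.filter_eq_self.mpr fun r hr => by simpa using hr
  obtain ⟨u, hu, hO⟩ := S.exists_order_mul_twoSidedIdealProd_eq_units_smul_of_symmDiff hl hnd hl hnd List.nodup_nil
    (l'' := []) (fun r => by simp) h h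
  refine ⟨u, ?_, by rw [hu, hfil]⟩
  rw [MulAction.mem_stabilizer_iff, ← hO, S.twoSidedIdealProd_nil, mul_one]

/-- **THE ARITHMETIC STABILISER IS CLOSED UNDER MULTIPLICATION**: if `O P_{supp g}(O)` and `O P_{supp g'}(O)` contain elements of
reduced norm `∏ localNorm` (are principal), so does `O P_{supp (g g')}(O)` — the set `{g ∈ (ℤ/2ℤ)^T : O P_{supp g}(O) principal}`
(whose cardinality is `z(O)` in `#fibre · z(O) = 2^{#T}`) is a subgroup. [cite: Voight2021, Lemma 18.5.1, Prop. 18.5.3 and (18.5.8)] [cite: Martin2018RefinedDimensions, §3 Prop. 12] -/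
theorem XiSetup.exists_norm_suppSort_mul (T : Finset ℕ) (hT : ∀ r ∈ T, r.Prime) {g g' : T → Multiplicative (ZMod 2)}
    (hg : ∃ x ∈ S.O * S.twoSidedIdealProd S.O (suppSort T g),
      reducedNorm ℚ S.D x = (((suppSort T g).map (localNorm Nplus Nminus)).prod : ℕ))
    (hg' : ∃ x ∈ S.O * S.twoSidedIdealProd S.O (suppSort T g'),
      reducedNorm ℚ S.D x = (((suppSort T g').map (localNorm Nplus Nminus)).prod : ℕ)) :
    ∃ x ∈ S.O * S.twoSidedIdealProd S.O (suppSort T (g * g')),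
      reducedNorm ℚ S.D x = (((suppSort T (g * g')).map (localNorm Nplus Nminus)).prod : ℕ) := by
  have hp : ∀ r ∈ suppSort T g, r.Prime := fun _ h => prime_of_mem_suppSort T hT g h
  have hp' : ∀ r ∈ suppSort T g', r.Prime := fun _ h => prime_of_mem_suppSort T hT g' h
  have hp'' : ∀ r ∈ suppSort T (g * g'), r.Prime := fun _ h => prime_of_mem_suppSort T hT _ h
  obtain ⟨y, hy⟩ := (S.exists_order_mul_twoSidedIdealProd_eq_units_smul_iff hp (nodup_suppSort T g)).mpr hg
  obtain ⟨y', hy'⟩ := (S.exists_order_mul_twoSidedIdealProd_eq_units_smul_iff hp' (nodup_suppSort T g')).mpr hg'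
  obtain ⟨y'', -, h''⟩ := S.exists_order_mul_twoSidedIdealProd_eq_units_smul_of_symmDiff hp (nodup_suppSort T g) hp'
    (nodup_suppSort T g') (nodup_suppSort T (g * g')) (mem_suppSort_mul_iff₆₁ T g g') hy hy'
  exact (S.exists_order_mul_twoSidedIdealProd_eq_units_smul_iff hp'' (nodup_suppSort T _)).mp ⟨y'', h''⟩

/-! ## §3 The normaliser: products, squares, commutators -/

/-- **THE SUPPORT OF A PRODUCT IS THE SYMMETRIC DIFFERENCE OF THE SUPPORTS: for `x, x'` with `O P_l(O) = (q x) O` and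
`O P_{l'}(O) = (q' x') O` (`q, q' > 0`; e.g. `x, x' ∈ N(O)`, Lemma 18.5.1) and any duplicate-free `l''` realising `l ∆ l'`,
`O P_{l''}(O) = (q'' x x') O` with `q'' = q q'/∏_{l ∩ l'} localNorm > 0`** — the map `N(O) → Idl(O)/Idl(ℤ) ≅ (ℤ/2ℤ)^{ω(N)}`,
`x ↦ supp(OxO)`, is a homomorphism. [cite: Voight2021, Lemma 18.5.1, Prop. 18.5.3 and (23.4.20)] -/
theorem XiSetup.exists_order_mul_twoSidedIdealProd_eq_units_smul_mul {l l' l'' : List ℕ} (hl : ∀ r ∈ l, r.Prime) (hnd : l.Nodup)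
    (hl' : ∀ r ∈ l', r.Prime) (hnd' : l'.Nodup) (hnd'' : l''.Nodup) (hmem : ∀ r, r ∈ l'' ↔ (r ∈ l ↔ r ∉ l'))
    {x x' y y' : S.Dˣ} {q q' : ℚ} (hq : 0 < q) (hq' : 0 < q') (hy : (y : S.D) = algebraMap ℚ S.D q * x)
    (hy' : (y' : S.D) = algebraMap ℚ S.D q' * x') (h : S.O * S.twoSidedIdealProd S.O l = y • S.O)
    (h' : S.O * S.twoSidedIdealProd S.O l' = y' • S.O) :
    ∃ (q'' : ℚ) (y'' : S.Dˣ), 0 < q'' ∧ (y'' : S.D) = algebraMap ℚ S.D q'' * (x * x') ∧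
      S.O * S.twoSidedIdealProd S.O l'' = y'' • S.O := by
  obtain ⟨y'', hy'', h''⟩ := S.exists_order_mul_twoSidedIdealProd_eq_units_smul_of_symmDiff hl hnd hl' hnd' hnd'' hmem h h'
  have hn0 : ((l.filter (· ∈ l')).map (localNorm Nplus Nminus)).prod ≠ 0 :=
    prod_localNorm_ne_zero₆₁ fun r' hr => hl r' (List.mem_filter.mp hr).1
  refine ⟨((((l.filter (· ∈ l')).map (localNorm Nplus Nminus)).prod : ℕ) : ℚ)⁻¹ * (q * q'), y'',
    mul_pos (inv_pos.mpr (by exact_mod_cast Nat.pos_of_ne_zero hn0)) (mul_pos hq hq'), ?_, h''⟩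
  rw [hy'', hy, hy', algebraMap_mul_mul_algebraMap_mul₆₁, ← mul_assoc, ← map_mul]

/-- **`x² ∈ ℚ^× O^×` FOR EVERY `x ∈ N(O)`: some positive rational multiple of `x²` stabilises `O`** — `N(O)/ℚ^×O^×` has exponent
`2` (it embeds in `Idl(O)/Idl(ℤ) ≅ ∏_{p ∣ N} ℤ/2ℤ`). [cite: Voight2021, Prop. 18.5.3 with (23.4.20), and Prop. 23.4.14] -/
theorem XiSetup.exists_sq_mem_stabilizer_of_conj_eq {x : S.Dˣ} (hx : x • (MulOpposite.op ((x⁻¹ : S.Dˣ) : S.D) • S.O) = S.O) :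
    ∃ u ∈ MulAction.stabilizer S.Dˣ S.O, ∃ c : ℚ, 0 < c ∧ (u : S.D) = algebraMap ℚ S.D c * (x * x) := by
  obtain ⟨l, hnd, hl, q, y, hq, hy, h⟩ := S.exists_order_mul_twoSidedIdealProd_eq_units_smul_of_conj_eq hx
  have hl' : ∀ r ∈ l, r.Prime := fun r hr => (hl r hr).1
  obtain ⟨u, hu, huv⟩ := S.exists_mem_stabilizer_eq_sq_of_order_mul_twoSidedIdealProd_eq_units_smul hl' hnd h
  have hn0 : (l.map (localNorm Nplus Nminus)).prod ≠ 0 := prod_localNorm_ne_zero₆₁ hl'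
  refine ⟨u, hu, (((l.map (localNorm Nplus Nminus)).prod : ℕ) : ℚ)⁻¹ * (q * q),
    mul_pos (inv_pos.mpr (by exact_mod_cast Nat.pos_of_ne_zero hn0)) (mul_pos hq hq), ?_⟩
  rw [huv, hy, algebraMap_mul_mul_algebraMap_mul₆₁, ← mul_assoc, ← map_mul]

/-- **COMMUTATORS OF NORMALISER ELEMENTS ARE UNITS OF `O`: for `x, x' ∈ N(O)`, `x'⁻¹ x⁻¹ … ` precisely `(x' x)⁻¹ (x x') ∈ O^×`**
(the stabiliser of `O`) — `N(O)/O^× ≅ PIdl(O) ≤ Idl(O)` is ABELIAN for an Eichler order over `ℤ` (the two-sided ideals commute).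
[cite: Voight2021, Lemma 18.5.1 with (23.4.20) and 18.5.7] -/
theorem XiSetup.commutator_mem_stabilizer_of_conj_eq {x x' : S.Dˣ} (hx : x • (MulOpposite.op ((x⁻¹ : S.Dˣ) : S.D) • S.O) = S.O)
    (hx' : x' • (MulOpposite.op ((x'⁻¹ : S.Dˣ) : S.D) • S.O) = S.O) :
    (x' * x)⁻¹ * (x * x') ∈ MulAction.stabilizer S.Dˣ S.O := by
  have hO := S.isZOrder_O
  obtain ⟨l, hnd, hl, q, y, hq, hy, h⟩ := S.exists_order_mul_twoSidedIdealProd_eq_units_smul_of_conj_eq hx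
  obtain ⟨l', hnd', hl', q', y', hq', hy', h'⟩ := S.exists_order_mul_twoSidedIdealProd_eq_units_smul_of_conj_eq hx'
  have hlp : ∀ r ∈ l, r.Prime := fun r hr => (hl r hr).1
  have hlp' : ∀ r ∈ l', r.Prime := fun r hr => (hl' r hr).1
  obtain ⟨l'', hnd'', hmem⟩ := exists_symmDiff_list₆₁ hnd hnd'
  have hmem' : ∀ r, r ∈ l'' ↔ (r ∈ l' ↔ r ∉ l) := fun r => by rw [hmem r]; tauto
  obtain ⟨z, hz, hz'⟩ := S.exists_order_mul_twoSidedIdealProd_eq_units_smul_of_symmDiff hlp hnd hlp' hnd' hnd'' hmem h h'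
  obtain ⟨w, hw, hw'⟩ := S.exists_order_mul_twoSidedIdealProd_eq_units_smul_of_symmDiff hlp' hnd' hlp hnd hnd'' hmem' h' h
  -- the two scalars agree
  have hperm : (l.filter (· ∈ l')).Perm (l'.filter (· ∈ l)) :=
    (List.perm_ext_iff_of_nodup (hnd.filter _) (hnd'.filter _)).mpr fun r => by
      simp only [List.mem_filter, decide_eq_true_eq]; tauto
  rw [(hperm.map _).prod_eq] at hz
  -- `z O = w O`, so `w⁻¹ z ∈ Stab(O)`; and `w⁻¹ z = (y' y)⁻¹ (y y') = (x' x)⁻¹ (x x')`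
  have hst : w⁻¹ * z ∈ MulAction.stabilizer S.Dˣ S.O := by
    rw [MulAction.mem_stabilizer_iff, mul_smul, inv_smul_eq_iff, ← hw', hz']
  set n := ((l'.filter (· ∈ l)).map (localNorm Nplus Nminus)).prod with hn
  have hn0 : n ≠ 0 := prod_localNorm_ne_zero₆₁ fun r' hr => hlp' r' (List.mem_filter.mp hr).1
  have hnq : ((n : ℕ) : ℚ) ≠ 0 := by exact_mod_cast hn0
  -- compare values in `D`
  have hval : ((w⁻¹ * z : S.Dˣ) : S.D) = (((x' * x)⁻¹ * (x * x') : S.Dˣ) : S.D) := by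
    -- `w = c y' y`, `z = c y y'` with the same central `c = n⁻¹`; `y = q x`, `y' = q' x'`
    have hc : IsUnit (algebraMap ℚ S.D ((n : ℚ)⁻¹ * (q * q'))) :=
      (IsUnit.mk0 _ (mul_ne_zero (inv_ne_zero hnq) (mul_ne_zero hq.ne' hq'.ne'))).map _
    have hzv : (z : S.D) = algebraMap ℚ S.D ((n : ℚ)⁻¹ * (q * q')) * ((x * x' : S.Dˣ) : S.D) := by
      rw [hz, hy, hy', algebraMap_mul_mul_algebraMap_mul₆₁, ← mul_assoc, ← map_mul, Units.val_mul]
    have hwv : (w : S.D) = algebraMap ℚ S.D ((n : ℚ)⁻¹ * (q * q')) * ((x' * x : S.Dˣ) : S.D) := by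
      rw [hw, hy', hy, algebraMap_mul_mul_algebraMap_mul₆₁, ← mul_assoc, ← map_mul, mul_comm q' q, Units.val_mul]
    have hzu : z = hc.unit * (x * x') := Units.ext (by rw [Units.val_mul, hc.unit_spec, hzv])
    have hwu : w = hc.unit * (x' * x) := Units.ext (by rw [Units.val_mul, hc.unit_spec, hwv])
    rw [hzu, hwu, mul_inv_rev, mul_assoc, inv_mul_cancel_left]
  rwa [Units.ext hval] at hst

/-- **`N(O)` is closed under products**: `x, x' ∈ N(O) ⟹ x x' ∈ N(O)`. [cite: Voight2021, Lemma 18.5.1] -/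
theorem XiSetup.mul_conj_eq_of_conj_eq {x x' : S.Dˣ} (hx : x • (MulOpposite.op ((x⁻¹ : S.Dˣ) : S.D) • S.O) = S.O)
    (hx' : x' • (MulOpposite.op ((x'⁻¹ : S.Dˣ) : S.D) • S.O) = S.O) :
    (x * x') • (MulOpposite.op (((x * x')⁻¹ : S.Dˣ) : S.D) • S.O) = S.O := by
  rw [← units_conj_units_conj x' x S.O, hx', hx]

/-! ## §4 The same for every left order `O_L(I)` -/

/-- **The symmetric-difference law at `O_L(I)`.** [cite: Voight2021, (23.4.20) and Lemma 17.4.13] -/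
theorem XiSetup.leftOrder_mul_twoSidedIdealProd_mul_leftOrder_mul_twoSidedIdealProd {I : Submodule ℤ S.D} (hI : I ∈ rightIdeals S.O)
    {l l' l'' : List ℕ} (hl : ∀ r ∈ l, r.Prime) (hnd : l.Nodup) (hl' : ∀ r ∈ l', r.Prime) (hnd' : l'.Nodup) (hnd'' : l''.Nodup)
    (hmem : ∀ r, r ∈ l'' ↔ (r ∈ l ↔ r ∉ l')) :
    (leftOrder I * S.twoSidedIdealProd (leftOrder I) l) * (leftOrder I * S.twoSidedIdealProd (leftOrder I) l') =
      (((l.filter (· ∈ l')).map (localNorm Nplus Nminus)).prod : ℤ) • (leftOrder I * S.twoSidedIdealProd (leftOrder I) l'') :=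
  (S.ofLeftOrder hI).order_mul_twoSidedIdealProd_mul_order_mul_twoSidedIdealProd hl hnd hl' hnd' hnd'' hmem

/-- **Commutators of elements of `N(O_L(I))` are units of `O_L(I)`.** [cite: Voight2021, Lemma 18.5.1 with (23.4.20) and Lemma 17.4.13] -/
theorem XiSetup.commutator_mem_stabilizer_leftOrder_of_conj_eq {I : Submodule ℤ S.D} (hI : I ∈ rightIdeals S.O) {x x' : S.Dˣ}
    (hx : x • (MulOpposite.op ((x⁻¹ : S.Dˣ) : S.D) • leftOrder I) = leftOrder I)
    (hx' : x' • (MulOpposite.op ((x'⁻¹ : S.Dˣ) : S.D) • leftOrder I) = leftOrder I) :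
    (x' * x)⁻¹ * (x * x') ∈ MulAction.stabilizer S.Dˣ (leftOrder I) :=
  (S.ofLeftOrder hI).commutator_mem_stabilizer_of_conj_eq hx hx'

/-- **Squares of elements of `N(O_L(I))` lie in `ℚ^× O_L(I)^×`.** [cite: Voight2021, Prop. 18.5.3 with (23.4.20) and Lemma 17.4.13] -/
theorem XiSetup.exists_sq_mem_stabilizer_leftOrder_of_conj_eq {I : Submodule ℤ S.D} (hI : I ∈ rightIdeals S.O) {x : S.Dˣ}
    (hx : x • (MulOpposite.op ((x⁻¹ : S.Dˣ) : S.D) • leftOrder I) = leftOrder I) :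
    ∃ u ∈ MulAction.stabilizer S.Dˣ (leftOrder I), ∃ c : ℚ, 0 < c ∧ (u : S.D) = algebraMap ℚ S.D c * (x * x) :=
  (S.ofLeftOrder hI).exists_sq_mem_stabilizer_of_conj_eq hx

end Brandt

end Literature.NumberTheory.Automorphic
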